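import Summits.MatrixMultiplication.MatrixMultiplication.Theses.ProbeRankScaling
import Literature.Computability.AlgebraicComplexity.KroneckerRank
import Literature.Computability.AlgebraicComplexity.KoszulFlatteningKronecker

/-!
# Route ProbeRankScaling — support `KroneckerClosure` (item stmt-MatrixMultiplication-7538)

The probe-rank filtration is closed under Kronecker products and probe ranks multiply:
from decompositions `⟨m,m,m⟩ = ∑_{i<r₀} w_i ⊗ u_i ⊗ v_i` and `⟨q,q,q⟩ = ∑_{j<r₁} w₁_j ⊗ u₁_j ⊗ v₁_j`
over `ℂ` we build the decomposition of `⟨mq,mq,mq⟩` with `r₀ r₁` terms whose probes are the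
Kronecker products of the factors' probes (read through the double-index relabelling
`doubleIndexEquiv m m q q : (Fin m × Fin m) × (Fin q × Fin q) ≃ Fin (mq) × Fin (mq)` of
`KroneckerRank.lean`), and the matrix rank of each new probe is (at most, in fact exactly) the
product of the ranks of the two factor probes.

Ingredients: "matrix tensors multiply" `kroneckerTensor_matMulTensor` (Bläser 2013, §5.2, p. 24;
tree `KroneckerRank.lean`), distributivity `Finset.sum_mul_sum`, the term relabelling
`finProdFinEquiv : Fin r₀ × Fin r₁ ≃ Fin (r₀ r₁)`, and `rank (A ⊗ₖ B) = rank A · rank B`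
(`matRank_kroneckerMap_mul`, tree `KoszulFlatteningKronecker.lean`) with `Matrix.rank_reindex`.

References: M. Bläser, *Fast Matrix Multiplication*, Theory of Computing Graduate Surveys 5 (2013),
Lemma 5.8 and p. 24 [Blaser2013]; M. Christandl, P. Vrana, J. Zuiddam, *Universal points in the
asymptotic spectrum of tensors*, JAMS 36 (2023), §1.1 (Kronecker product of tensors)
[ChristandlVranaZuiddam2023]; V. Pan, *How to multiply matrices faster*, LNCS 179 (1984)
(Kronecker closure of bilinear algorithms) [Pan1984].
-/

noncomputable section

open scoped BigOperators

namespace Summit.MatrixMultiplication.MatrixMultiplication.Theorems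

open Literature.Computability.AlgebraicComplexity

/-- **Probe ranks multiply.** The Kronecker product of two probes `f ∈ ℂ^{m×m}`, `g ∈ ℂ^{q×q}`,
read as an `mq × mq` matrix through `(doubleIndexEquiv m m q q).symm`, is the reindexed Kronecker
product of matrices, so its rank is `rank f · rank g` (stated as `≤`, which is what the route item
consumes). -/
theorem probeRankScaling_rank_kroneckerProbe_le (m q : ℕ) (f : Fin m × Fin m → ℂ)
    (g : Fin q × Fin q → ℂ) :
    (Matrix.of (Function.curry fun a : Fin (m * q) × Fin (m * q) =>
        f ((doubleIndexEquiv m m q q).symm a).1 * g ((doubleIndexEquiv m m q q).symm a).2)).rank ≤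
      (Matrix.of (Function.curry f)).rank * (Matrix.of (Function.curry g)).rank := by
  have h : (Matrix.of (Function.curry fun a : Fin (m * q) × Fin (m * q) =>
        f ((doubleIndexEquiv m m q q).symm a).1 * g ((doubleIndexEquiv m m q q).symm a).2)) =
      Matrix.reindex finProdFinEquiv finProdFinEquiv
        (Matrix.kroneckerMap (· * ·) (Matrix.of (Function.curry f))
          (Matrix.of (Function.curry g))) := by
    ext x y
    rfl
  rw [h, Matrix.rank_reindex, matRank_kroneckerMap_mul]

/-- **Kronecker closure of the probe-rank filtration** (general form over `ℂ`): decompositions of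
`⟨m,m,m⟩` with `r₀` terms and of `⟨q,q,q⟩` with `r₁` terms give a decomposition of `⟨mq,mq,mq⟩`
with `r₀ r₁` terms, term `l ↔ (i, j)` via `finProdFinEquiv.symm`, whose three probes are the
Kronecker products of the `i`-th and `j`-th factor probes and hence have matrix rank at most the
product of the factor ranks (Bläser 2013, Lemma 5.8 with p. 24, made explicit on probes). -/
theorem probeRankScaling_kroneckerClosure (m q r₀ r₁ : ℕ)
    (w u v : Fin r₀ → Fin m × Fin m → ℂ) (w₁ u₁ v₁ : Fin r₁ → Fin q × Fin q → ℂ)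
    (h₀ : matMulTensor ℂ m m m = ∑ l, triad (w l) (u l) (v l))
    (h₁ : matMulTensor ℂ q q q = ∑ l, triad (w₁ l) (u₁ l) (v₁ l)) :
    ∃ (e : Fin (r₀ * r₁) ≃ Fin r₀ × Fin r₁)
      (w' u' v' : Fin (r₀ * r₁) → Fin (m * q) × Fin (m * q) → ℂ),
      matMulTensor ℂ (m * q) (m * q) (m * q) = ∑ l, triad (w' l) (u' l) (v' l) ∧
      ∀ l, (Matrix.of (Function.curry (w' l))).rank ≤
          (Matrix.of (Function.curry (w (e l).1))).rank *
            (Matrix.of (Function.curry (w₁ (e l).2))).rank ∧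
        (Matrix.of (Function.curry (u' l))).rank ≤
          (Matrix.of (Function.curry (u (e l).1))).rank *
            (Matrix.of (Function.curry (u₁ (e l).2))).rank ∧
        (Matrix.of (Function.curry (v' l))).rank ≤
          (Matrix.of (Function.curry (v (e l).1))).rank *
            (Matrix.of (Function.curry (v₁ (e l).2))).rank := by
  set D := doubleIndexEquiv m m q q with hD
  refine ⟨finProdFinEquiv.symm,
    fun l a => w (finProdFinEquiv.symm l).1 (D.symm a).1 * w₁ (finProdFinEquiv.symm l).2 (D.symm a).2,
    fun l b => u (finProdFinEquiv.symm l).1 (D.symm b).1 * u₁ (finProdFinEquiv.symm l).2 (D.symm b).2,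
    fun l c => v (finProdFinEquiv.symm l).1 (D.symm c).1 * v₁ (finProdFinEquiv.symm l).2 (D.symm c).2,
    ?_, fun l => ⟨probeRankScaling_rank_kroneckerProbe_le m q _ _,
      probeRankScaling_rank_kroneckerProbe_le m q _ _,
      probeRankScaling_rank_kroneckerProbe_le m q _ _⟩⟩
  funext a b c
  rw [sum_triad_apply]
  conv_lhs => rw [← D.apply_symm_apply a, ← D.apply_symm_apply b, ← D.apply_symm_apply c]
  rw [hD, ← kroneckerTensor_matMulTensor, kroneckerTensor_apply, h₀, h₁, sum_triad_apply,
    sum_triad_apply, Finset.sum_mul_sum, ← Fintype.sum_prod_type']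
  refine Fintype.sum_equiv finProdFinEquiv _ _ fun p => ?_
  simp only [Equiv.symm_apply_apply]
  ring

/-- Item `stmt-MatrixMultiplication-7538` (`KroneckerClosure`, support of route ProbeRankScaling):
the probe-rank filtration is closed under Kronecker products and probe ranks multiply. -/
theorem kroneckerClosure_proof :
    Summit.MatrixMultiplication.MatrixMultiplication.Theses.ProbeRankScaling.KroneckerClosure := by
  unfold Summit.MatrixMultiplication.MatrixMultiplication.Theses.ProbeRankScaling.KroneckerClosure
  intro m q r₀ r₁ w u v w₁ u₁ v₁ h₀ h₁
  exact probeRankScaling_kroneckerClosure m q r₀ r₁ w u v w₁ u₁ v₁ h₀ h₁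

end Summit.MatrixMultiplication.MatrixMultiplication.Theorems

end
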